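import Mathlib.Analysis.Calculus.Deriv.MeanValue
import Summits.Ventures.CertifiedManyBodySolver.Downfold.InflationComposition
import HarnessLib

/-!
# The secant premise behind a MEASURED inflation sensitivity (`S^meas = 1.2 × |secant slope|`)

Venture CertifiedManyBodySolver, cell `pub/hubbard-downfold` (stage S1 = downfolding front end),
seat hubbard-downfold-mod-2; namespace `Summit.Ventures.CertifiedManyBodySolver.Downfold.Inflation`.
`router/INFLATION-RULES.md` §P.5 / §P.9(c) replace a default power-law sensitivity by a measured
one: two structure points `V₀ e^{-δ}` and `V₀` (or a `±δ` pair) give a secant slope `m` of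
`f(v) = log X(V₀ e^v) - log X(V₀)`, and at a point whose log-volume mismatch is `|v| ≤ Δ` the box is
padded by `e^{±1.2 |m| |v|}`. This file certifies exactly what the factor `1.2` assumes (§P.5c): if
the log-derivative `f'` is `K`-Lipschitz on the sampled-plus-target range then
`|f v - f 0| ≤ (|m| + K (δ + Δ)) |v|` for a one-sided pair and `(m + K · max δ Δ) |v|` for a
two-sided pair (`m` = the larger of the two slopes), so the printed `1.2 |m|` encloses as soon as
the curvature term is at most `|m| / 5`. Everything is PROVED (two applications of Lagrange's mean
value theorem, `exists_hasDerivAt_eq_slope`). WHAT THIS IS NOT: a value of `K` — the curvature bound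
is a modelling input of §P.5c (there DERIVED from `t ≈ t_pd² / Δ_pd` with the runner's measured
`dΔ_pd / d ln V`), not something this file supplies.

* `sub_eq_deriv_mul_of_pos` / `sub_eq_deriv_mul_of_neg` — `f v - f 0 = f' ζ · v` with `ζ` strictly
  between `0` and `v` (mean value theorem, packaged for both signs of `v`).
* `abs_sub_le_secant_left` — one-sided pair `[-δ, 0]`, `m = (f 0 - f (-δ)) / δ`:
  `|f v - f 0| ≤ (|m| + K (δ + Δ)) · |v|` for `|v| ≤ Δ`.
* `abs_sub_le_secant_two_sided` — `±δ` pair, `m = max |m₋| |m₊|`: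
  `|f v - f 0| ≤ (m + K · max δ Δ) · |v|`.
* `abs_sub_le_one_add_mul_of_margin` — if the curvature term `C` satisfies `C ≤ c · M` then a bound
  `(M + C) |v|` is at most `(1 + c) M |v|` (`c = 1/5` prints the rule's `× 1.2`).
* `mem_Icc_mul_exp_of_abs_log_div_le` — multiplicative reading of a log bound:
  `|log (x / x₀)| ≤ s`, `x, x₀ > 0` ⇒ `x ∈ [x₀ e^{-s}, x₀ e^{s}]` (via `exp_neg_le_of_abs_log_le`).
-/

namespace Summit.Ventures.CertifiedManyBodySolver.Downfold.Inflation

open Real Set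

/-- Mean value theorem packaged for `v > 0`: if `f` is continuous on `[-R, R]` and has derivative
`f'` on `(-R, R)`, then for `0 < v ≤ R` there is `ζ ∈ (0, v)` with `f v - f 0 = f' ζ · v`.
[folklore] -/
theorem sub_eq_deriv_mul_of_pos {f f' : ℝ → ℝ} {R v : ℝ}
    (hcont : ContinuousOn f (Icc (-R) R)) (hder : ∀ x ∈ Ioo (-R) R, HasDerivAt f (f' x) x)
    (hv : 0 < v) (hvR : v ≤ R) : ∃ ζ ∈ Ioo 0 v, f v - f 0 = f' ζ * v := by
  have hsub : Icc 0 v ⊆ Icc (-R) R := Icc_subset_Icc (by linarith) hvR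
  obtain ⟨ζ, hζ, hslope⟩ := exists_hasDerivAt_eq_slope f f' hv (hcont.mono hsub)
    (fun x hx => hder x ⟨by linarith [hx.1], by linarith [hx.2]⟩)
  refine ⟨ζ, hζ, ?_⟩
  rw [hslope, sub_zero, div_mul_cancel₀ _ hv.ne']

/-- Mean value theorem packaged for `v < 0`: for `-R ≤ v < 0` there is `ζ ∈ (v, 0)` with
`f v - f 0 = f' ζ · v`. [folklore] -/
theorem sub_eq_deriv_mul_of_neg {f f' : ℝ → ℝ} {R v : ℝ}
    (hcont : ContinuousOn f (Icc (-R) R)) (hder : ∀ x ∈ Ioo (-R) R, HasDerivAt f (f' x) x)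
    (hv : v < 0) (hvR : -R ≤ v) : ∃ ζ ∈ Ioo v 0, f v - f 0 = f' ζ * v := by
  have hsub : Icc v 0 ⊆ Icc (-R) R := Icc_subset_Icc hvR (by linarith)
  obtain ⟨ζ, hζ, hslope⟩ := exists_hasDerivAt_eq_slope f f' hv (hcont.mono hsub)
    (fun x hx => hder x ⟨by linarith [hx.1], by linarith [hx.2]⟩)
  refine ⟨ζ, hζ, ?_⟩
  rw [hslope, zero_sub, div_neg, neg_mul, div_mul_cancel₀ _ hv.ne]
  ring

/-- The secant slope of a one-sided pair is a derivative value: `m = (f 0 - f (-δ)) / δ = f' ξ` for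
some `ξ ∈ (-δ, 0)` (`0 < δ ≤ R`). [folklore] -/
theorem exists_deriv_eq_secant_left {f f' : ℝ → ℝ} {R δ : ℝ}
    (hcont : ContinuousOn f (Icc (-R) R)) (hder : ∀ x ∈ Ioo (-R) R, HasDerivAt f (f' x) x)
    (hδ : 0 < δ) (hδR : δ ≤ R) : ∃ ξ ∈ Ioo (-δ) 0, f' ξ = (f 0 - f (-δ)) / δ := by
  have hsub : Icc (-δ) 0 ⊆ Icc (-R) R := Icc_subset_Icc (by linarith) (by linarith)
  have hlt : -δ < 0 := by linarith
  obtain ⟨ξ, hξ, hslope⟩ := exists_hasDerivAt_eq_slope f f' hlt (hcont.mono hsub)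
    (fun x hx => hder x ⟨by linarith [hx.1], by linarith [hx.2]⟩)
  exact ⟨ξ, hξ, by rw [hslope, sub_neg_eq_add, zero_add]⟩

/-- The secant slope of the right half of a two-sided pair: `(f δ - f 0) / δ = f' ξ` for some
`ξ ∈ (0, δ)`. [folklore] -/
theorem exists_deriv_eq_secant_right {f f' : ℝ → ℝ} {R δ : ℝ}
    (hcont : ContinuousOn f (Icc (-R) R)) (hder : ∀ x ∈ Ioo (-R) R, HasDerivAt f (f' x) x)
    (hδ : 0 < δ) (hδR : δ ≤ R) : ∃ ξ ∈ Ioo 0 δ, f' ξ = (f δ - f 0) / δ := by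
  obtain ⟨ξ, hξ, h⟩ := sub_eq_deriv_mul_of_pos hcont hder hδ hδR
  exact ⟨ξ, hξ, by rw [eq_div_iff hδ.ne', ← h]⟩

/-- Core estimate: if `f v - f 0 = f' ζ · v`, `f' ξ = m`, `f'` is `K`-Lipschitz between `ζ` and `ξ`
(`|f' ζ - f' ξ| ≤ K |ζ - ξ|`), and `|ζ - ξ| ≤ D` with `K ≥ 0`, then `|f v - f 0| ≤ (|m| + K D) |v|`.
[folklore] -/
theorem abs_sub_le_of_deriv_data {fv f0 dζ dξ m ζ ξ v K D : ℝ} (hK : 0 ≤ K)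
    (hmv : fv - f0 = dζ * v) (hm : dξ = m) (hlip : |dζ - dξ| ≤ K * |ζ - ξ|) (hD : |ζ - ξ| ≤ D) :
    |fv - f0| ≤ (|m| + K * D) * |v| := by
  rw [hmv, abs_mul]
  apply mul_le_mul_of_nonneg_right _ (abs_nonneg v)
  have h1 : |dζ - dξ| ≤ K * D := hlip.trans (mul_le_mul_of_nonneg_left hD hK)
  rw [← hm]
  obtain ⟨h1a, h1b⟩ := abs_le.1 h1
  refine abs_le.2 ⟨?_, ?_⟩
  · linarith [neg_abs_le dξ]
  · linarith [le_abs_self dξ]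

/-- **One-sided secant enclosure (INFL-P §P.5c).** `f` continuous on `[-R, R]` with derivative
`f'` on `(-R, R)`, `f'` `K`-Lipschitz there (`K ≥ 0`); sampled step `[-δ, 0]` with secant slope
`m = (f 0 - f (-δ)) / δ`; target range `|v| ≤ Δ` (`δ, Δ ≤ R`). Then
`|f v - f 0| ≤ (|m| + K (δ + Δ)) · |v|` — so the printed `1.2 |m|` encloses iff `K (δ + Δ) ≤ |m| / 5`.
[folklore] -/
theorem abs_sub_le_secant_left {f f' : ℝ → ℝ} {R δ Δ K v : ℝ}
    (hcont : ContinuousOn f (Icc (-R) R)) (hder : ∀ x ∈ Ioo (-R) R, HasDerivAt f (f' x) x)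
    (hlip : ∀ x ∈ Ioo (-R) R, ∀ y ∈ Ioo (-R) R, |f' x - f' y| ≤ K * |x - y|) (hK : 0 ≤ K)
    (hδ : 0 < δ) (hδR : δ ≤ R) (hΔR : Δ ≤ R) (hv : |v| ≤ Δ) :
    |f v - f 0| ≤ (|(f 0 - f (-δ)) / δ| + K * (δ + Δ)) * |v| := by
  obtain ⟨hv1, hv2⟩ := abs_le.1 hv
  obtain ⟨ξ, ⟨hξ1, hξ2⟩, hξ⟩ := exists_deriv_eq_secant_left hcont hder hδ hδR
  have hξR : ξ ∈ Ioo (-R) R := ⟨by linarith, by linarith⟩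
  rcases lt_trichotomy v 0 with hneg | hzero | hpos
  · obtain ⟨ζ, ⟨hζ1, hζ2⟩, hζ⟩ := sub_eq_deriv_mul_of_neg hcont hder hneg (by linarith)
    have hζR : ζ ∈ Ioo (-R) R := ⟨by linarith, by linarith⟩
    refine abs_sub_le_of_deriv_data hK hζ hξ (hlip ζ hζR ξ hξR) ?_
    exact abs_le.2 ⟨by linarith, by linarith⟩
  · subst hzero
    simp
  · obtain ⟨ζ, ⟨hζ1, hζ2⟩, hζ⟩ := sub_eq_deriv_mul_of_pos hcont hder hpos (by linarith)
    have hζR : ζ ∈ Ioo (-R) R := ⟨by linarith, by linarith⟩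
    refine abs_sub_le_of_deriv_data hK hζ hξ (hlip ζ hζR ξ hξR) ?_
    exact abs_le.2 ⟨by linarith, by linarith⟩

/-- **Two-sided secant enclosure (INFL-P §P.5 `±δ` pair, §P.9(c)).** With both half-steps
sampled, `m₋ = (f 0 - f (-δ)) / δ`, `m₊ = (f δ - f 0) / δ` and `m = max |m₋| |m₊|`, the target is
compared with the slope ON ITS OWN SIDE, so the curvature term shrinks from `δ + Δ` to `max δ Δ`:
`|f v - f 0| ≤ (m + K · max δ Δ) · |v|` for `|v| ≤ Δ`. [folklore] -/
theorem abs_sub_le_secant_two_sided {f f' : ℝ → ℝ} {R δ Δ K v : ℝ}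
    (hcont : ContinuousOn f (Icc (-R) R)) (hder : ∀ x ∈ Ioo (-R) R, HasDerivAt f (f' x) x)
    (hlip : ∀ x ∈ Ioo (-R) R, ∀ y ∈ Ioo (-R) R, |f' x - f' y| ≤ K * |x - y|) (hK : 0 ≤ K)
    (hδ : 0 < δ) (hδR : δ ≤ R) (hΔR : Δ ≤ R) (hv : |v| ≤ Δ) :
    |f v - f 0| ≤
      (max |(f 0 - f (-δ)) / δ| |(f δ - f 0) / δ| + K * max δ Δ) * |v| := by
  obtain ⟨hv1, hv2⟩ := abs_le.1 hv
  have hδm : δ ≤ max δ Δ := le_max_left _ _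
  have hΔm : Δ ≤ max δ Δ := le_max_right _ _
  rcases lt_trichotomy v 0 with hneg | hzero | hpos
  · obtain ⟨ξ, ⟨hξ1, hξ2⟩, hξ⟩ := exists_deriv_eq_secant_left hcont hder hδ hδR
    have hξR : ξ ∈ Ioo (-R) R := ⟨by linarith, by linarith⟩
    obtain ⟨ζ, ⟨hζ1, hζ2⟩, hζ⟩ := sub_eq_deriv_mul_of_neg hcont hder hneg (by linarith)
    have hζR : ζ ∈ Ioo (-R) R := ⟨by linarith, by linarith⟩
    have hD : |ζ - ξ| ≤ max δ Δ := abs_le.2 ⟨by linarith, by linarith⟩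
    calc |f v - f 0| ≤ (|(f 0 - f (-δ)) / δ| + K * max δ Δ) * |v| :=
          abs_sub_le_of_deriv_data hK hζ hξ (hlip ζ hζR ξ hξR) hD
      _ ≤ (max |(f 0 - f (-δ)) / δ| |(f δ - f 0) / δ| + K * max δ Δ) * |v| := by
          apply mul_le_mul_of_nonneg_right _ (abs_nonneg v)
          linarith [le_max_left |(f 0 - f (-δ)) / δ| |(f δ - f 0) / δ|]
  · subst hzero
    simp
  · obtain ⟨ξ, ⟨hξ1, hξ2⟩, hξ⟩ := exists_deriv_eq_secant_right hcont hder hδ hδR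
    have hξR : ξ ∈ Ioo (-R) R := ⟨by linarith, by linarith⟩
    obtain ⟨ζ, ⟨hζ1, hζ2⟩, hζ⟩ := sub_eq_deriv_mul_of_pos hcont hder hpos (by linarith)
    have hζR : ζ ∈ Ioo (-R) R := ⟨by linarith, by linarith⟩
    have hD : |ζ - ξ| ≤ max δ Δ := abs_le.2 ⟨by linarith, by linarith⟩
    calc |f v - f 0| ≤ (|(f δ - f 0) / δ| + K * max δ Δ) * |v| :=
          abs_sub_le_of_deriv_data hK hζ hξ (hlip ζ hζR ξ hξR) hD
      _ ≤ (max |(f 0 - f (-δ)) / δ| |(f δ - f 0) / δ| + K * max δ Δ) * |v| := by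
          apply mul_le_mul_of_nonneg_right _ (abs_nonneg v)
          linarith [le_max_right |(f 0 - f (-δ)) / δ| |(f δ - f 0) / δ|]

/-- **The margin factor.** If the curvature term `C` is at most `c · M` (`M` = the measured slope
magnitude), a bound `(M + C) · a` is at most `(1 + c) · M · a` for `a ≥ 0`; with `c = 1/5` this is
the rule's `S^meas = 1.2 × |m|` (§P.5 / §P.9(c)), with `c = 1/2` the `× 1.5` kept outside the
measured range (§P.5c). [folklore] -/
theorem abs_sub_le_one_add_mul_of_margin {y M C c a : ℝ} (hy : y ≤ (M + C) * a) (hC : C ≤ c * M)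
    (ha : 0 ≤ a) : y ≤ (1 + c) * M * a := by
  have : (M + C) * a ≤ (1 + c) * M * a := by
    apply mul_le_mul_of_nonneg_right _ ha
    linarith
  exact hy.trans this

/-- **Multiplicative reading** of a log-scale bound (the box pad `× e^{±s}` of §P.0a): for
`x, x₀ > 0` with `|log (x / x₀)| ≤ s`, `x ∈ [x₀ · e^{-s}, x₀ · e^{s}]`. [folklore] -/
theorem mem_Icc_mul_exp_of_abs_log_div_le {x x₀ s : ℝ} (hx : 0 < x) (hx₀ : 0 < x₀)
    (h : |Real.log (x / x₀)| ≤ s) : x ∈ Icc (x₀ * Real.exp (-s)) (x₀ * Real.exp s) := by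
  obtain ⟨h1, h2⟩ := exp_neg_le_of_abs_log_le (div_pos hx hx₀) h
  constructor
  · have := mul_le_mul_of_nonneg_left h1 hx₀.le
    rwa [mul_div_cancel₀ _ hx₀.ne'] at this
  · have := mul_le_mul_of_nonneg_left h2 hx₀.le
    rwa [mul_div_cancel₀ _ hx₀.ne'] at this

/-- **Assembled rule (one-sided pair, multiplicative form).** Under the hypotheses of
`abs_sub_le_secant_left`, with `X v = x₀ · exp (f v - f 0)`-type positivity made explicit as
`x = x₀ · exp (f v - f 0)`, the value at mismatch `v` lies in `x₀ · [e^{-S|v|}, e^{S|v|}]` with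
`S = |m| + K (δ + Δ)`. [folklore] -/
theorem mem_Icc_secant_left {f f' : ℝ → ℝ} {R δ Δ K v x x₀ : ℝ}
    (hcont : ContinuousOn f (Icc (-R) R)) (hder : ∀ x ∈ Ioo (-R) R, HasDerivAt f (f' x) x)
    (hlip : ∀ x ∈ Ioo (-R) R, ∀ y ∈ Ioo (-R) R, |f' x - f' y| ≤ K * |x - y|) (hK : 0 ≤ K)
    (hδ : 0 < δ) (hδR : δ ≤ R) (hΔR : Δ ≤ R) (hv : |v| ≤ Δ) (hx₀ : 0 < x₀)
    (hx : x = x₀ * Real.exp (f v - f 0)) :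
    x ∈ Icc (x₀ * Real.exp (-((|(f 0 - f (-δ)) / δ| + K * (δ + Δ)) * |v|)))
      (x₀ * Real.exp ((|(f 0 - f (-δ)) / δ| + K * (δ + Δ)) * |v|)) := by
  have hxpos : 0 < x := by rw [hx]; exact mul_pos hx₀ (Real.exp_pos _)
  apply mem_Icc_mul_exp_of_abs_log_div_le hxpos hx₀
  have : Real.log (x / x₀) = f v - f 0 := by
    rw [hx, mul_comm, mul_div_assoc, div_self hx₀.ne', mul_one, Real.log_exp]
  rw [this]
  exact abs_sub_le_secant_left hcont hder hlip hK hδ hδR hΔR hv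

/-! ### Sign-definite volume derivative ⇒ one-sided deviation (INFL-P §P.5d, the asymmetric pad)

If every determination agrees on the SIGN of `d log X / d log V` (for hoppings: `X` decreases with
volume) and the log-slope is at most `S`, a real cell SMALLER than the DFT cell (`v ≤ 0`) can only
move `X` UP, by at most `S |v|`; a larger one only DOWN. With the mismatch-plus-comparator range
`v ∈ [-Δ, Δ₀]` this gives the asymmetric enclosure `f v - f 0 ∈ [-S Δ₀, S Δ]`, i.e.
`x ∈ x₀ · [e^{-S Δ₀}, e^{S Δ}]` — §P.5d keeps `Δ₀ = 0.03` on the short side. The long side wants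
the full log-distance from the DFT cell to the farthest admissible real cell. -/

/-- **Decreasing coordinate, smaller real cell ⇒ truth above, by at most `S |v|`** (§P.5d).
`f` continuous on `[-R, R]` with derivative `f'` on `(-R, R)`, `-S ≤ f' ≤ 0` there; then for
`-R ≤ v ≤ 0`: `f v - f 0 ∈ [0, S |v|]`. [folklore] -/
theorem sub_mem_Icc_of_deriv_nonpos_of_nonpos {f f' : ℝ → ℝ} {R S v : ℝ}
    (hcont : ContinuousOn f (Icc (-R) R)) (hder : ∀ x ∈ Ioo (-R) R, HasDerivAt f (f' x) x)
    (hsign : ∀ x ∈ Ioo (-R) R, f' x ≤ 0) (hslope : ∀ x ∈ Ioo (-R) R, -S ≤ f' x)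
    (hv : v ≤ 0) (hvR : -R ≤ v) : f v - f 0 ∈ Icc 0 (S * |v|) := by
  rcases eq_or_lt_of_le hv with hzero | hneg
  · subst hzero
    simp
  · obtain ⟨ζ, ⟨hζ1, hζ2⟩, hζ⟩ := sub_eq_deriv_mul_of_neg hcont hder hneg hvR
    have hζR : ζ ∈ Ioo (-R) R := ⟨by linarith, by linarith⟩
    have h1 := hsign ζ hζR
    have h2 := hslope ζ hζR
    rw [hζ, abs_of_neg hneg]
    constructor
    · nlinarith
    · nlinarith

/-- **Decreasing coordinate, larger real cell ⇒ truth below, by at most `S |v|`** (§P.5d mirrored):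
for `0 ≤ v ≤ R`, `f v - f 0 ∈ [-(S |v|), 0]`. [folklore] -/
theorem sub_mem_Icc_of_deriv_nonpos_of_nonneg {f f' : ℝ → ℝ} {R S v : ℝ}
    (hcont : ContinuousOn f (Icc (-R) R)) (hder : ∀ x ∈ Ioo (-R) R, HasDerivAt f (f' x) x)
    (hsign : ∀ x ∈ Ioo (-R) R, f' x ≤ 0) (hslope : ∀ x ∈ Ioo (-R) R, -S ≤ f' x)
    (hv : 0 ≤ v) (hvR : v ≤ R) : f v - f 0 ∈ Icc (-(S * |v|)) 0 := by
  rcases eq_or_lt_of_le hv with hzero | hpos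
  · subst hzero
    simp
  · obtain ⟨ζ, ⟨hζ1, hζ2⟩, hζ⟩ := sub_eq_deriv_mul_of_pos hcont hder hpos hvR
    have hζR : ζ ∈ Ioo (-R) R := ⟨by linarith, by linarith⟩
    have h1 := hsign ζ hζR
    have h2 := hslope ζ hζR
    rw [hζ, abs_of_pos hpos]
    constructor
    · nlinarith
    · nlinarith

/-- **Asymmetric pad (§P.5d(iii)).** Under the sign-definite hypothesis (`-S ≤ f' ≤ 0` on `(-R, R)`,
`S ≥ 0`), if the admissible real cells satisfy `v ∈ [-Δ, Δ₀]` (`Δ` = mismatch plus comparator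
uncertainty on the compressed side, `Δ₀` = comparator uncertainty on the other side; both in `[0, R]`),
then `f v - f 0 ∈ [-S Δ₀, S Δ]`. [folklore] -/
theorem sub_mem_Icc_asym_of_deriv_nonpos {f f' : ℝ → ℝ} {R S Δ Δ₀ v : ℝ}
    (hcont : ContinuousOn f (Icc (-R) R)) (hder : ∀ x ∈ Ioo (-R) R, HasDerivAt f (f' x) x)
    (hsign : ∀ x ∈ Ioo (-R) R, f' x ≤ 0) (hslope : ∀ x ∈ Ioo (-R) R, -S ≤ f' x) (hS : 0 ≤ S)
    (hΔ : 0 ≤ Δ) (hΔ₀ : 0 ≤ Δ₀) (hΔR : Δ ≤ R) (hΔ₀R : Δ₀ ≤ R) (hv : v ∈ Icc (-Δ) Δ₀) :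
    f v - f 0 ∈ Icc (-(S * Δ₀)) (S * Δ) := by
  obtain ⟨hv1, hv2⟩ := hv
  rcases le_or_gt v 0 with hle | hgt
  · obtain ⟨h1, h2⟩ :=
      sub_mem_Icc_of_deriv_nonpos_of_nonpos hcont hder hsign hslope hle (by linarith)
    have habs : |v| ≤ Δ := by rw [abs_of_nonpos hle]; linarith
    constructor
    · nlinarith
    · exact h2.trans (mul_le_mul_of_nonneg_left habs hS)
  · obtain ⟨h1, h2⟩ :=
      sub_mem_Icc_of_deriv_nonpos_of_nonneg hcont hder hsign hslope hgt.le (by linarith)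
    have habs : |v| ≤ Δ₀ := by rw [abs_of_pos hgt]; exact hv2
    constructor
    · have := mul_le_mul_of_nonneg_left habs hS
      linarith
    · nlinarith

/-- **Asymmetric pad, multiplicative form** (the printed `× [e^{-S Δ₀}, e^{+S Δ}]` of §P.5d): with
`x = x₀ · exp (f v - f 0)`, `x₀ > 0`, under the hypotheses of `sub_mem_Icc_asym_of_deriv_nonpos`:
`x ∈ [x₀ e^{-S Δ₀}, x₀ e^{S Δ}]`. [folklore] -/
theorem mem_Icc_asym_of_deriv_nonpos {f f' : ℝ → ℝ} {R S Δ Δ₀ v x x₀ : ℝ}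
    (hcont : ContinuousOn f (Icc (-R) R)) (hder : ∀ x ∈ Ioo (-R) R, HasDerivAt f (f' x) x)
    (hsign : ∀ x ∈ Ioo (-R) R, f' x ≤ 0) (hslope : ∀ x ∈ Ioo (-R) R, -S ≤ f' x) (hS : 0 ≤ S)
    (hΔ : 0 ≤ Δ) (hΔ₀ : 0 ≤ Δ₀) (hΔR : Δ ≤ R) (hΔ₀R : Δ₀ ≤ R) (hv : v ∈ Icc (-Δ) Δ₀)
    (hx₀ : 0 < x₀) (hx : x = x₀ * Real.exp (f v - f 0)) :
    x ∈ Icc (x₀ * Real.exp (-(S * Δ₀))) (x₀ * Real.exp (S * Δ)) := by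
  obtain ⟨h1, h2⟩ :=
    sub_mem_Icc_asym_of_deriv_nonpos hcont hder hsign hslope hS hΔ hΔ₀ hΔR hΔ₀R hv
  rw [hx]
  constructor
  · exact mul_le_mul_of_nonneg_left (Real.exp_le_exp.2 h1) hx₀.le
  · exact mul_le_mul_of_nonneg_left (Real.exp_le_exp.2 h2) hx₀.le

/-! ## §dop D.5c/D.5d — a filling with a located, signed, TWO-RATE pressure lever (self-doping)

`router/INFLATION-RULES.md` D.5c (Y-124, pre-registered) and D.5d (YBCO, the first MEASURED rate by a
charge producer): the plane filling `n(P)` FALLS under pressure at a rate located only as a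
bracket, `dn/dP ∈ [-r_hi, -r_lo]` (`0 ≤ r_lo ≤ r_hi`), valid on an initial-slope range
`[0, P_v]`. Then for `0 ≤ P ≤ P_v`: `n(P) - n(0) ∈ [-r_hi P, -r_lo P]`, and with the end box
`n(0) ∈ [n_lo, n_hi]`: `n(P) ∈ [n_lo - r_hi P, n_hi - r_lo P]` — one-sided in DIRECTION,
two-membered in SIZE, never averaged. -/

/-- **Two-rate signed enclosure of an increment.** `f` continuous on `[0, P_v]` with derivative
`f'` on `(0, P_v)` and `-r_hi ≤ f' ≤ -r_lo` there; then for `0 ≤ P ≤ P_v`,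
`f P - f 0 ∈ [-r_hi P, -r_lo P]`. [folklore] -/
theorem sub_mem_Icc_of_deriv_mem_Icc {f f' : ℝ → ℝ} {Pv r_lo r_hi P : ℝ}
    (hcont : ContinuousOn f (Icc 0 Pv)) (hder : ∀ x ∈ Ioo 0 Pv, HasDerivAt f (f' x) x)
    (hlo : ∀ x ∈ Ioo 0 Pv, -r_hi ≤ f' x) (hhi : ∀ x ∈ Ioo 0 Pv, f' x ≤ -r_lo)
    (hP0 : 0 ≤ P) (hPv : P ≤ Pv) : f P - f 0 ∈ Icc (-r_hi * P) (-r_lo * P) := by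
  have hdiff : DifferentiableOn ℝ f (interior (Icc 0 Pv)) := by
    rw [interior_Icc]; exact fun z hz => (hder z hz).differentiableAt.differentiableWithinAt
  have hge : ∀ z ∈ interior (Icc 0 Pv), -r_hi ≤ deriv f z := by
    rw [interior_Icc]; intro z hz; rw [(hder z hz).deriv]; exact hlo z hz
  have hle : ∀ z ∈ interior (Icc 0 Pv), deriv f z ≤ -r_lo := by
    rw [interior_Icc]; intro z hz; rw [(hder z hz).deriv]; exact hhi z hz
  have h0 : (0 : ℝ) ∈ Icc 0 Pv := left_mem_Icc.2 (hP0.trans hPv)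
  have hPm : P ∈ Icc 0 Pv := ⟨hP0, hPv⟩
  have h1 := (convex_Icc 0 Pv).mul_sub_le_image_sub_of_le_deriv hcont hdiff hge 0 h0 P hPm hP0
  have h2 := (convex_Icc 0 Pv).image_sub_le_mul_sub_of_deriv_le hcont hdiff hle 0 h0 P hPm hP0
  constructor <;> nlinarith

/-- **The filling box at pressure `P`** (D.5c (ii)): end box `n(0) ∈ [n_lo, n_hi]` plus the two-rate
lever ⇒ `n(P) ∈ [n_lo - r_hi P, n_hi - r_lo P]` for `0 ≤ P ≤ P_v`. [folklore] -/
theorem filling_mem_Icc_of_rates {n n' : ℝ → ℝ} {Pv r_lo r_hi P n_lo n_hi : ℝ}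
    (hcont : ContinuousOn n (Icc 0 Pv)) (hder : ∀ x ∈ Ioo 0 Pv, HasDerivAt n (n' x) x)
    (hlo : ∀ x ∈ Ioo 0 Pv, -r_hi ≤ n' x) (hhi : ∀ x ∈ Ioo 0 Pv, n' x ≤ -r_lo)
    (hP0 : 0 ≤ P) (hPv : P ≤ Pv) (hbox : n 0 ∈ Icc n_lo n_hi) :
    n P ∈ Icc (n_lo - r_hi * P) (n_hi - r_lo * P) := by
  obtain ⟨h1, h2⟩ := sub_mem_Icc_of_deriv_mem_Icc hcont hder hlo hhi hP0 hPv
  exact ⟨by linarith [hbox.1], by linarith [hbox.2]⟩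

/-- **Y-124 (D.5c) at the lever's validity edge `P = 2.7 GPa`** with `n(0) ∈ [0.86, 0.88]` and
`dn/dP ∈ [-0.025, -0.012]` holes/Cu/GPa: `n(2.7) ∈ [0.86 - 0.0675, 0.88 - 0.0324] = [0.7925, 0.8476]`
(the arithmetic of the pre-registered rule; EXTRAPOLATED beyond 2.7 GPa is NOT licensed by this
lemma). [folklore] -/
theorem y124_filling_box_at_2p7 :
    ((86 : ℝ) / 100 - (25 / 1000) * (27 / 10) = 7925 / 10000) ∧
      ((88 : ℝ) / 100 - (12 / 1000) * (27 / 10) = 8476 / 10000) := by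
  constructor <;> norm_num

/-- **YBCO M18 @2 GPa (D.5d, MEASURED rate class near-opt 0.0036 holes/Cu/GPa)**: the shift
`0.0036 · 2 = 0.0072` is inside the filling floor `±0.02` — no widening of the transported `n` row.
[folklore] -/
theorem ybco_m18_shift_inside_floor : (36 : ℝ) / 10000 * 2 < 2 / 100 := by norm_num

end Summit.Ventures.CertifiedManyBodySolver.Downfold.Inflation
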